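import Mathlib.MeasureTheory.Group.Measure
import Mathlib.GroupTheory.Complement
import Mathlib.GroupTheory.Index
import HarnessLib

/-!
# The index of an open subgroup as a ratio of Haar measures, and the index of a measure-scaling image:
# `[U : V] · μ(V) = μ(U)`, and `[U : ψU] = c` when `μ.map ψ = c • μ` (Bernstein–Zelevinsky 1977, 1.7; Casselman 1995, §1.5)

Topic `NumberTheory/Automorphic`; namespace `Literature.NumberTheory.Automorphic.DoubleCosetIndex` (continues ★ `IwahoriDoubleCosetIndex`).
THEOREMS ONLY (no definition, no named fact, no instance, no notation, no `sorry`).  Cell `hodgecm-mathlib`, F0∕P3 «U3-mult», N5 road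
(Casselman's square-integrability criterion ★ `UnitaryGroup.U3SquareIntegrableExponents` [Casselman1995, Thm. 4.4.6]), file (R3b) of the
GROUP∕MEASURE half (seat B-p04 (g31)).  The point: for a compact open subgroup `N_K` of the unipotent radical `N` and a torus element `a`
contracting it, `[N_K : a N_K a⁻¹] = δ_P(a)⁻¹`, because conjugation by `a` scales the Haar measure of `N` by the modulus (the tree's ★
`IsTopSemidirect.map_conjBy_eq_modularCharacter_smul`, ★ `map_torusConj_cmBorel_eq_modularCharacter_smul`: `μ_N.map (n ↦ t⁻¹ n t) = Δ_P(t) • μ_N`).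
Combined with ★ `DoubleCosetIndex.ncard_orbit_eq_relIndex_conj_inf` this is the volume growth `#(K aᵐ K ∕ K) = δ_P(a)⁻ᵐ` of
[Casselman1995, §1.5; BruhatTits1972, (4.4.4)] used on both sides of Thm. 4.4.6.  Everything here is measure theory on ONE measurable group
(the radical `N` of the application, as a type); no parabolic structure, no topology.

RESULTS.
* §1 **`relIndex_mul_measure`**: `V ≤ U` subgroups of a measurable group, `V` measurable of finite index in `U`, `μ` left-invariant ⇒
  `[U : V] · μ(V) = μ(U)` (relative form of Mathlib's `Subgroup.index_mul_measure`: `U` is the disjoint union of the `[U : V]` translates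
  `sV`, `s` in a left transversal).  `relIndex_eq_measure_div`: `[U : V] = μ(U) ∕ μ(V)` for `0 < μ(V) < ∞`.
* §2 **`measure_eq_mul_measure_image`**: `μ.map ψ = c • μ`, `ψ` measurable and injective, `S` and `ψ '' S` measurable ⇒ `μ(S) = c · μ(ψ '' S)`.
* §3 **`relIndex_eq_of_map_eq_smul`**: if moreover `(V : Set N) = ψ '' U` for subgroups `V ≤ U` with `V` measurable, `0 < μ(V) < ∞`, then
  `([U : V] : ℝ≥0∞) = c` (finite index is a CONSEQUENCE) — in the application `ψ = (n ↦ a n a⁻¹)`, `c = Δ_P(a⁻¹) = δ_P(a)⁻¹`, `U = N ∩ K`: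
  **`[N ∩ K : a(N ∩ K)a⁻¹] = δ_P(a)⁻¹`**; `relIndex_eq_of_map_eq_nnreal_smul` (the `ℝ≥0`-scalar spelling of ★ `map_torusConj_cmBorel_eq_modularCharacter_nnreal_smul`).

## References
* [BernsteinZelevinsky1977] I. N. Bernstein, A. V. Zelevinsky, *Induced representations of reductive `p`-adic groups I*, Ann. Sci. ÉNS 10
  (1977), 1.7 (the module of an automorphism; `Δ_P`).
* [Casselman1995] W. Casselman, *Introduction to the theory of admissible representations of `p`-adic reductive groups* (draft 1 May 1995),
  §1.5 (`δ_P` and the volumes `meas(K a K)`), Prop. 1.4.4, Thm. 4.4.6.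
* [BruhatTits1972] F. Bruhat, J. Tits, *Groupes réductifs sur un corps local I*, Publ. Math. IHÉS 41 (1972), (4.4.4).
-/

set_option autoImplicit false

open scoped Pointwise ENNReal NNReal
open MeasureTheory

namespace Literature.NumberTheory.Automorphic

namespace DoubleCosetIndex

variable {N : Type*} [Group N] [MeasurableSpace N]

/-! ## §1 `[U : V] · μ(V) = μ(U)` for a measurable finite-index subgroup `V ≤ U` -/

/-- **`[U : V] · μ(V) = μ(U)`** for subgroups `V ≤ U` of a measurable group with `V` measurable of finite index in `U` and `μ`
left-invariant: `U = ⨆_{s ∈ S} sV` over a left transversal `S ⊆ U` of `V` in `U`, `#S = [U : V]`, `μ(sV) = μ(V)`.  Relative form of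
Mathlib's `Subgroup.index_mul_measure`. [cite: BernsteinZelevinsky1977, 1.7] [cite: Casselman1995, §1.5] -/
theorem relIndex_mul_measure [MeasurableMul N] (μ : Measure N) [μ.IsMulLeftInvariant] {U V : Subgroup N} (hVU : V ≤ U)
    (hV : MeasurableSet (V : Set N)) (hfin : V.relIndex U ≠ 0) :
    (V.relIndex U : ℝ≥0∞) * μ V = μ U := by
  classical
  -- a left transversal `S` of `H = V.subgroupOf U` in `↥U`
  set H : Subgroup ↥U := V.subgroupOf U with hH
  obtain ⟨S, hS, -⟩ := H.exists_isComplement_left 1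
  haveI : H.FiniteIndex := ⟨hfin⟩
  have hSfin : S.Finite := hS.finite_left_iff.mpr inferInstance
  -- the translates `sV ⊆ N`, `s ∈ S`
  have hcover : (U : Set N) = ⋃ s ∈ hSfin.toFinset, ((s : ↥U) : N) • (V : Set N) := by
    ext x
    simp only [Set.mem_iUnion, Set.Finite.mem_toFinset, exists_prop]
    constructor
    · intro hx
      have hx1 : (⟨x, hx⟩ : ↥U) ∈ S * (H : Set ↥U) := by rw [hS.mul_eq]; exact Set.mem_univ _
      obtain ⟨s, hs, h, hh, hsh⟩ := Set.mem_mul.1 hx1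
      refine ⟨s, hs, ?_⟩
      rw [Set.mem_smul_set]
      refine ⟨(h : N), Subgroup.mem_subgroupOf.1 hh, ?_⟩
      have := congrArg (fun y : ↥U => (y : N)) hsh
      simpa using this
    · rintro ⟨s, -, hx⟩
      obtain ⟨v, hv, rfl⟩ := Set.mem_smul_set.1 hx
      exact U.mul_mem s.2 (hVU hv)
  have hdisj : Set.PairwiseDisjoint (hSfin.toFinset : Set ↥U) (fun s : ↥U => ((s : ↥U) : N) • (V : Set N)) := by
    intro s hs s' hs' hne
    have hs0 : s ∈ S := (hSfin.mem_toFinset).1 hs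
    have hs0' : s' ∈ S := (hSfin.mem_toFinset).1 hs'
    have hd := hS.pairwiseDisjoint_smul hs0 hs0' hne
    rw [Function.onFun, Set.disjoint_left] at hd ⊢
    intro x hx hx'
    obtain ⟨v, hv, rfl⟩ := Set.mem_smul_set.1 hx
    obtain ⟨v', hv', hvv⟩ := Set.mem_smul_set.1 hx'
    have hvU : v ∈ U := hVU hv
    have hmem : (s : ↥U) • (⟨v, hvU⟩ : ↥U) ∈ s • (H : Set ↥U) :=
      Set.smul_mem_smul_set (Subgroup.mem_subgroupOf.2 hv)
    refine hd hmem ?_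
    rw [Set.mem_smul_set]
    refine ⟨⟨v', hVU hv'⟩, Subgroup.mem_subgroupOf.2 hv', Subtype.ext ?_⟩
    simpa using hvv
  have hmeas : ∀ s ∈ hSfin.toFinset, MeasurableSet (((s : ↥U) : N) • (V : Set N)) := fun s _ => hV.const_smul _
  calc (V.relIndex U : ℝ≥0∞) * μ V = (hSfin.toFinset.card : ℝ≥0∞) * μ V := by
        congr 2
        rw [Subgroup.relIndex, ← hH, ← hS.card_left, ← Set.ncard_eq_toFinset_card S hSfin, Nat.card_coe_set_eq]
    _ = ∑ s ∈ hSfin.toFinset, μ (((s : ↥U) : N) • (V : Set N)) := by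
        simp_rw [measure_smul]; rw [Finset.sum_const, nsmul_eq_mul]
    _ = μ (⋃ s ∈ hSfin.toFinset, ((s : ↥U) : N) • (V : Set N)) := (measure_biUnion_finset hdisj hmeas).symm
    _ = μ U := by rw [← hcover]

/-- **`[U : V] = μ(U) ∕ μ(V)`** for `0 < μ(V) < ∞` (same hypotheses). [cite: BernsteinZelevinsky1977, 1.7] [cite: Casselman1995, §1.5] -/
theorem relIndex_eq_measure_div [MeasurableMul N] (μ : Measure N) [μ.IsMulLeftInvariant] {U V : Subgroup N} (hVU : V ≤ U)
    (hV : MeasurableSet (V : Set N)) (hfin : V.relIndex U ≠ 0) (hV0 : μ V ≠ 0) (hVtop : μ V ≠ ∞) :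
    (V.relIndex U : ℝ≥0∞) = μ U / μ V := by
  rw [← relIndex_mul_measure μ hVU hV hfin, ENNReal.mul_div_cancel_right hV0 hVtop]

/-- **Finite index from finite measure**: if `V ≤ U`, `V` measurable with `μ(V) ≠ 0` and `μ(U) < ∞` for a left-invariant `μ`, then `[U : V] < ∞`
(a compact open subgroup has finite index over any open subgroup). [cite: BernsteinZelevinsky1977, 1.7] -/
theorem relIndex_ne_zero_of_measure [MeasurableMul N] (μ : Measure N) [μ.IsMulLeftInvariant] {U V : Subgroup N} (hVU : V ≤ U)
    (hV : MeasurableSet (V : Set N)) (hV0 : μ V ≠ 0) (hUtop : μ U ≠ ∞) : V.relIndex U ≠ 0 := by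
  classical
  intro h0
  -- an infinite transversal gives infinitely many disjoint translates of `V` inside `U`
  set H : Subgroup ↥U := V.subgroupOf U with hH
  have hHi : H.index = 0 := h0
  obtain ⟨S, hS, hS1⟩ := H.exists_isComplement_left 1
  have hSinf : S.Infinite := by
    intro hSf
    haveI : Finite S := hSf
    haveI : Nonempty S := ⟨⟨_, hS1⟩⟩
    have hpos : 0 < Nat.card S := Nat.card_pos
    rw [hS.card_left, hHi] at hpos
    exact lt_irrefl 0 hpos
  -- any finite subset `T ⊆ S` gives `#T · μ(V) ≤ μ(U)`
  have hbound : ∀ n : ℕ, (n : ℝ≥0∞) * μ V ≤ μ U := by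
    intro n
    obtain ⟨T, hTS, hTcard⟩ := hSinf.exists_subset_card_eq n
    have hdisj : Set.PairwiseDisjoint (T : Set ↥U) (fun s : ↥U => ((s : ↥U) : N) • (V : Set N)) := by
      intro s hs s' hs' hne
      have hd := hS.pairwiseDisjoint_smul (hTS hs) (hTS hs') hne
      rw [Function.onFun, Set.disjoint_left] at hd ⊢
      intro x hx hx'
      obtain ⟨v, hv, rfl⟩ := Set.mem_smul_set.1 hx
      obtain ⟨v', hv', hvv⟩ := Set.mem_smul_set.1 hx'
      have hvU : v ∈ U := hVU hv
      have hmem : (s : ↥U) • (⟨v, hvU⟩ : ↥U) ∈ s • (H : Set ↥U) :=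
        Set.smul_mem_smul_set (Subgroup.mem_subgroupOf.2 hv)
      refine hd hmem ?_
      rw [Set.mem_smul_set]
      refine ⟨⟨v', hVU hv'⟩, Subgroup.mem_subgroupOf.2 hv', Subtype.ext ?_⟩
      simpa using hvv
    have hmeas : ∀ s ∈ T, MeasurableSet (((s : ↥U) : N) • (V : Set N)) := fun s _ => hV.const_smul _
    have hsub : (⋃ s ∈ T, ((s : ↥U) : N) • (V : Set N)) ⊆ (U : Set N) := by
      intro x hx
      simp only [Set.mem_iUnion, exists_prop] at hx
      obtain ⟨s, -, hx⟩ := hx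
      obtain ⟨v, hv, rfl⟩ := Set.mem_smul_set.1 hx
      exact U.mul_mem s.2 (hVU hv)
    calc (n : ℝ≥0∞) * μ V = ∑ s ∈ T, μ (((s : ↥U) : N) • (V : Set N)) := by
          simp_rw [measure_smul]; rw [Finset.sum_const, nsmul_eq_mul, hTcard]
      _ = μ (⋃ s ∈ T, ((s : ↥U) : N) • (V : Set N)) := (measure_biUnion_finset hdisj hmeas).symm
      _ ≤ μ U := measure_mono hsub
  -- contradiction with `μ(U) < ∞`, `μ(V) > 0`
  have hVtop : μ V ≠ ∞ := ne_top_of_le_ne_top hUtop (measure_mono (show (V : Set N) ⊆ U from hVU))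
  obtain ⟨n, hn⟩ := exists_nat_gt ((μ U).toNNReal / (μ V).toNNReal)
  have h1 := hbound n
  have hUr : μ U = ((μ U).toNNReal : ℝ≥0∞) := (ENNReal.coe_toNNReal hUtop).symm
  have hVr : μ V = ((μ V).toNNReal : ℝ≥0∞) := (ENNReal.coe_toNNReal hVtop).symm
  rw [hUr, hVr] at h1
  have hV0' : (μ V).toNNReal ≠ 0 := by
    intro h; apply hV0; rw [hVr, h, ENNReal.coe_zero]
  have h2 : ((n : ℝ≥0) : ℝ≥0∞) * ((μ V).toNNReal : ℝ≥0∞) ≤ ((μ U).toNNReal : ℝ≥0∞) := by simpa using h1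
  rw [← ENNReal.coe_mul, ENNReal.coe_le_coe] at h2
  have h3 : (n : ℝ≥0) ≤ (μ U).toNNReal / (μ V).toNNReal := by rwa [le_div_iff₀ (pos_iff_ne_zero.2 hV0')]
  exact (not_lt.2 h3) hn

/-! ## §2 `μ(S) = c · μ(ψ '' S)` when `μ.map ψ = c • μ` -/

omit [Group N] in
/-- **`μ(S) = c · μ(ψ '' S)`** for `ψ` measurable and injective with `μ.map ψ = c • μ` and `S`, `ψ '' S` measurable:
`S = ψ⁻¹(ψ S)` and `μ(ψ⁻¹ T) = (μ.map ψ)(T) = c μ(T)` (the module of an automorphism). [cite: BernsteinZelevinsky1977, 1.7] -/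
theorem measure_eq_mul_measure_image (μ : Measure N) {ψ : N → N} (hψ : Measurable ψ) (hinj : Function.Injective ψ) {c : ℝ≥0∞}
    (hμ : μ.map ψ = c • μ) {S : Set N} (hψS : MeasurableSet (ψ '' S)) : μ S = c * μ (ψ '' S) := by
  have h := congrArg (fun ν : Measure N => ν (ψ '' S)) hμ
  simp only [Measure.smul_apply, smul_eq_mul] at h
  rwa [Measure.map_apply hψ hψS, Set.preimage_image_eq S hinj] at h

/-! ## §3 `[U : ψU] = c`: the index of a measure-scaling image -/

/-- **`([U : V] : ℝ≥0∞) = c`** when `(V : Set N) = ψ '' U` for subgroups `V ≤ U`, `ψ` measurable injective with `μ.map ψ = c • μ` (`μ`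
left-invariant), `V` measurable with `0 < μ(V)`, `μ(U) < ∞`: `[U : V] μ(V) = μ(U) = c μ(V)`.  In the application `N` is the unipotent
radical, `U = N ∩ K`, `ψ = (n ↦ a n a⁻¹)`, `c = Δ_P(a⁻¹) = δ_P(a)⁻¹` (★ `map_torusConj_cmBorel_eq_modularCharacter_smul` at `t = a⁻¹`):
**`[N ∩ K : a(N ∩ K)a⁻¹] = δ_P(a)⁻¹`**. [cite: Casselman1995, §1.5] [cite: BernsteinZelevinsky1977, 1.7] [cite: BruhatTits1972, (4.4.4)] -/
theorem relIndex_eq_of_map_eq_smul [MeasurableMul N] (μ : Measure N) [μ.IsMulLeftInvariant] {ψ : N → N} (hψ : Measurable ψ)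
    (hinj : Function.Injective ψ) {c : ℝ≥0∞} (hμ : μ.map ψ = c • μ) {U V : Subgroup N} (hVU : V ≤ U) (hVψ : (V : Set N) = ψ '' U)
    (hV : MeasurableSet (V : Set N)) (hV0 : μ V ≠ 0) (hUtop : μ U ≠ ∞) :
    (V.relIndex U : ℝ≥0∞) = c := by
  have hVtop : μ V ≠ ∞ := ne_top_of_le_ne_top hUtop (measure_mono (show (V : Set N) ⊆ U from hVU))
  have hfin := relIndex_ne_zero_of_measure μ hVU hV hV0 hUtop
  have h1 := relIndex_mul_measure μ hVU hV hfin
  have h2 : μ U = c * μ V := by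
    have := measure_eq_mul_measure_image μ hψ hinj hμ (S := (U : Set N)) (by rw [← hVψ]; exact hV)
    rwa [← hVψ] at this
  rw [h2] at h1
  exact (ENNReal.mul_left_inj hV0 hVtop).1 h1

/-- The same with an `ℝ≥0`-valued scalar acting on the measure (the spelling `μ.map ψ = (c : ℝ≥0) • μ` of ★
`map_torusConj_cmBorel_eq_modularCharacter_nnreal_smul`): `([U : V] : ℝ≥0∞) = c`, hence `[U : V] = c` in `ℝ≥0`.
[cite: Casselman1995, §1.5] [cite: BernsteinZelevinsky1977, 1.7] -/
theorem relIndex_eq_of_map_eq_nnreal_smul [MeasurableMul N] (μ : Measure N) [μ.IsMulLeftInvariant] {ψ : N → N} (hψ : Measurable ψ)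
    (hinj : Function.Injective ψ) {c : ℝ≥0} (hμ : μ.map ψ = c • μ) {U V : Subgroup N} (hVU : V ≤ U) (hVψ : (V : Set N) = ψ '' U)
    (hV : MeasurableSet (V : Set N)) (hV0 : μ V ≠ 0) (hUtop : μ U ≠ ∞) :
    (V.relIndex U : ℝ≥0) = c := by
  have hμ' : μ.map ψ = (c : ℝ≥0∞) • μ := by rw [hμ]; rfl
  have h := relIndex_eq_of_map_eq_smul μ hψ hinj hμ' hVU hVψ hV hV0 hUtop
  exact_mod_cast h

end DoubleCosetIndex

end Literature.NumberTheory.Automorphic
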